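import Literature.NumberTheory.GaloisRepresentations.LabelledWeightsTwistPeriods
import Literature.NumberTheory.GaloisRepresentations.LabelledWeightsRankOneBaseChange
import Literature.NumberTheory.PAdicHodge.RankOneEmbeddingEvaluation
import HarnessLib

/-!
# The corner unit of a rank-one period and the twisting theorem for labelled weights

Let `F/ℚ_p` be a field with a period-ring datum `𝔅` of `Γ_F = Gal(F̄/F)` over `F/ℚ_p` and a
`Γ_F`-equivariant section `ι : F̄ → B` over `F` with `ι(F̄) ⊆ Fil^0 B` (for `B = B_dR(F)`:
`F̄ ⊆ B_dR⁺`).  For a finite coefficient field `E₀/ℚ_p` write `R₀ = (Fin 1 → E₀) ⊗_{ℚ_p} B` and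
`ev_j : R₀ → B`, `j : E₀ → F̄` a `ℚ_p`-embedding, for the evaluations of the accepted
`RankOneEmbeddingEvaluation` (jointly injective, reading the filtration).

## Main results

* `evalEmb_mul`, `exists_forall_evalEmb_eq` — the evaluations are multiplicative and **jointly
  surjective**: every family `(t_j)_j ∈ B^{Hom(E₀,F̄)}` is the family of evaluations of some
  `y ∈ R₀` (the embeddings matrix is invertible, `disc(E₀/ℚ_p) ≠ 0`); with joint injectivity this is
  the decomposition `R₀ ≅ ∏_j B` of [FontaineAsterisque223III, Exp. III Prop. 1.5.2].
* `perMul_coeffIncl_eq_zero_of_ne` — **off-label corners kill the `τ`-isotypic part**: if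
  `e ∈ R₀` is supported at ONE embedding `j` NOT over the label `τ₀ : F → E₀`
  (`(c ⊗ 1) e = (1 ⊗ ι(j c)) e` for all `c ∈ E₀`), then `e · x = 0` for every `x` in the
  `τ`-isotypic part of `M ⊗_{ℚ_p} B` over ANY coefficient field `E ⊇ E₀`, `τ = (E₀ ⊆ E) ∘ τ₀`
  (`B` acts injectively through the unit `ι(a - j(τ₀ a))`).
* `exists_twistUnit` — **the corner unit**: if `d₀ ∈ R₀` has `ev_j d₀ = 0` off `τ₀` and
  `ev_j d₀` invertible with inverse in `Fil^{-k} B` over `τ₀`, there is `u₀ ∈ R₀ ∩ (E₀ ⊗ Fil^{-k})`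
  with `(u₀ d₀) · x = x` on the `τ`-isotypic part of `M ⊗ B` over every `E ⊇ E₀`.
* `labelledHodgeTateWeights_twist_of_generator` — **the twisting theorem**: for a rank-one
  `rE₀ : Γ_F → GL₁(E₀)` and `d₀ ∈ D_{τ₀}(rE₀) ∩ (E₀ ⊗ Fil^k) ∖ (E₀ ⊗ Fil^{k+1})` (a generator of
  exact `τ₀`-weight `k`), and any `E`-representation `ρ` on `M` over a coefficient field `E ⊇ E₀`,
  the twist `ρ' = det rE₀ · ρ` has **`HT_τ(ρ') = HT_τ(ρ) + k`**, provided every element of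
  `Fil^i B ∖ Fil^{i+1} B` has an inverse in `Fil^{-i} B` (true in the field `B_dR`).  This is
  Patrikis' `HT_τ(ρ ⊗ χ) = HT_τ(ρ) + HT_τ(χ)` [Patrikis2019, §2.3.1, §2.7.1] for a de Rham
  character `χ`, in the abstract form consumed by `LabelledWeightsTwistSchema`.

The proof of the last theorem feeds the corner unit into the accepted abstract twisting theorem
`PeriodRingData.labelledHodgeTateWeights_of_twistUnit` (`LabelledWeightsTwistPeriods`); the
exactness `ev_j d₀ ∉ Fil^{k+1}` at EVERY embedding over `τ₀` is transported along the
`Γ_F`-orbit of embeddings over a label (`exists_absGalEmbComp_eq`, `evalEmb_absGalEmbComp`).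

## References
* [FontaineAsterisque223III] J.-M. Fontaine, *Représentations p-adiques semi-stables*,
  Astérisque 223, Exp. III §1.5, Prop. 1.5.2.
* [Patrikis2019] S. Patrikis, *Variations on a theorem of Tate*, Mem. AMS 1238, §2.3.1, §2.7.1.
-/

noncomputable section

open Field Matrix TensorProduct
open scoped MatrixGroups TensorProduct

namespace Literature.NumberTheory.PAdicHodge

open Literature.NumberTheory.GaloisRepresentations

namespace RankOneLabelledWeights

-- Mathlib's own global value of `maxSynthPendingDepth` (see `PeriodRingData.rank_D_le`); the large
-- tensor types also need a higher instance-synthesis budget.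
set_option maxSynthPendingDepth 3
set_option synthInstance.maxHeartbeats 200000

variable {F : Type} [Field F] {p : ℕ} [Fact p.Prime] [Algebra ℚ_[p] F]
  (𝔅 : PeriodRingData.{0, 0, 0, 0} (absoluteGaloisGroup F) ℚ_[p] F)
  (ι : AlgebraicClosure F →+* 𝔅.B)
  {E : Type} [Field E] [Algebra ℚ_[p] E]
  (j : E →ₐ[ℚ_[p]] AlgebraicClosure F)
  (hιq : ∀ c : ℚ_[p], algebraMap ℚ_[p] 𝔅.B c = ι (algebraMap ℚ_[p] (AlgebraicClosure F) c))

/-! ### The evaluations are ring homomorphisms and jointly surjective -/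

/-- `ev_j` is multiplicative. [cite: FontaineAsterisque223III, Exp. III §1.5] -/
theorem evalEmb_mul (x y : (Fin 1 → E) ⊗[ℚ_[p]] 𝔅.B) :
    evalEmb 𝔅 ι j hιq (x * y) = evalEmb 𝔅 ι j hιq x * evalEmb 𝔅 ι j hιq y := by
  induction x using TensorProduct.induction_on with
  | zero => rw [zero_mul, map_zero, zero_mul]
  | tmul m b =>
    induction y using TensorProduct.induction_on with
    | zero => rw [mul_zero, map_zero, mul_zero]
    | tmul m' b' =>
      rw [Algebra.TensorProduct.tmul_mul_tmul, evalEmb_tmul, evalEmb_tmul, evalEmb_tmul, Pi.mul_apply,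
        map_mul, map_mul, mul_mul_mul_comm]
    | add y z hy hz => rw [mul_add, map_add, map_add, hy, hz, mul_add]
  | add x z hx hz => rw [add_mul, map_add, map_add, hx, hz, add_mul]

/-- `ev_j 1 = 1`. [cite: FontaineAsterisque223III, Exp. III §1.5] -/
theorem evalEmb_one : evalEmb 𝔅 ι j hιq 1 = 1 := by
  rw [Algebra.TensorProduct.one_def, evalEmb_tmul, Pi.one_apply, map_one, map_one, one_mul]

/-- `ev_j (1 ⊗ b) = b`. [cite: FontaineAsterisque223III, Exp. III §1.5] -/
theorem evalEmb_one_tmul (b : 𝔅.B) : evalEmb 𝔅 ι j hιq ((1 : Fin 1 → E) ⊗ₜ[ℚ_[p]] b) = b := by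
  rw [evalEmb_tmul, Pi.one_apply, map_one, map_one, one_mul]

/-- `ev_{j'} (c ⊗ 1) = ι(j' c)` for the constant vector `c`. [cite: FontaineAsterisque223III, Exp. III §1.5] -/
theorem evalEmb_const_tmul_one (c : E) :
    evalEmb 𝔅 ι j hιq ((fun _ : Fin 1 => c) ⊗ₜ[ℚ_[p]] (1 : 𝔅.B)) = ι (j c) := by
  rw [evalEmb_tmul, mul_one]

/-- **Joint surjectivity of the evaluations.**  For every family `t : Hom_{ℚ_p}(E, F̄) → B` there is
`y ∈ (Fin 1 → E) ⊗_{ℚ_p} B` with `ev_{j'} y = t j'` for all `j'` (the embeddings matrix of a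
`ℚ_p`-basis of `E` is invertible). [cite: FontaineAsterisque223III, Exp. III Prop. 1.5.2] -/
theorem exists_forall_evalEmb_eq [FiniteDimensional ℚ_[p] E]
    (t : (E →ₐ[ℚ_[p]] AlgebraicClosure F) → 𝔅.B) :
    ∃ y : (Fin 1 → E) ⊗[ℚ_[p]] 𝔅.B,
      ∀ j' : E →ₐ[ℚ_[p]] AlgebraicClosure F, evalEmb 𝔅 ι j' hιq y = t j' := by
  classical
  obtain ⟨m, b, ε, N, hN⟩ := exists_coords_eq_sum_evalEmb 𝔅 ι hιq (E := E)
  set N' : Matrix (Fin m) (Fin m) 𝔅.B := ι.mapMatrix N with hN'def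
  -- `coords y = N' *ᵥ (ev_{ε i} y)_i`
  have hco : ∀ y : (Fin 1 → E) ⊗[ℚ_[p]] 𝔅.B,
      (fun k => coords 𝔅 b y k) = N' *ᵥ fun i => evalEmb 𝔅 ι (ε i) hιq y := by
    intro y
    funext k
    rw [hN y k, Matrix.mulVec, dotProduct]
    rfl
  -- `N'` is surjective, hence invertible
  have hsurj : Function.Surjective N'.mulVec := by
    intro v
    refine ⟨fun i => evalEmb 𝔅 ι (ε i) hιq ((coords 𝔅 b).symm (Finsupp.equivFunOnFinite.symm v)), ?_⟩
    rw [← hco]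
    funext k
    rw [LinearEquiv.apply_symm_apply]
    rfl
  have hU : IsUnit N' := Matrix.mulVec_surjective_iff_isUnit.mp hsurj
  have hdet : IsUnit N'.det := (Matrix.isUnit_iff_isUnit_det N').mp hU
  -- the element with coordinates `N' *ᵥ (t ∘ ε)`
  set v : Fin m → 𝔅.B := fun i => t (ε i) with hvdef
  set y : (Fin 1 → E) ⊗[ℚ_[p]] 𝔅.B :=
    (coords 𝔅 b).symm (Finsupp.equivFunOnFinite.symm (N' *ᵥ v)) with hydef
  have hy : (fun k => coords 𝔅 b y k) = N' *ᵥ v := by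
    funext k
    rw [hydef, LinearEquiv.apply_symm_apply]
    rfl
  have hev : (fun i => evalEmb 𝔅 ι (ε i) hιq y) = v := by
    have h1 : N' *ᵥ (fun i => evalEmb 𝔅 ι (ε i) hιq y) = N' *ᵥ v := by rw [← hco, hy]
    have h2 := congrArg (N'⁻¹.mulVec) h1
    simp only [Matrix.mulVec_mulVec, Matrix.nonsing_inv_mul _ hdet, Matrix.one_mulVec] at h2
    exact h2
  refine ⟨y, fun j' => ?_⟩
  obtain ⟨i, rfl⟩ := ε.surjective j'
  exact congrFun hev i

/-- **Joint bijectivity, pointwise form**: two elements with the same evaluations are equal.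
[cite: FontaineAsterisque223III, Exp. III Prop. 1.5.2] -/
theorem eq_of_forall_evalEmb_eq [FiniteDimensional ℚ_[p] E] {x y : (Fin 1 → E) ⊗[ℚ_[p]] 𝔅.B}
    (h : ∀ j' : E →ₐ[ℚ_[p]] AlgebraicClosure F, evalEmb 𝔅 ι j' hιq x = evalEmb 𝔅 ι j' hιq y) :
    x = y := by
  rw [← sub_eq_zero]
  exact eq_zero_of_forall_evalEmb_eq_zero 𝔅 ι hιq _ fun j' => by rw [map_sub, h j', sub_self]

/-! ### Corner elements -/

/-- **Corner elements.**  For every embedding `j` there is `e_j ∈ (Fin 1 → E) ⊗ B` with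
`ev_j e_j = 1` and `ev_{j'} e_j = 0` for `j' ≠ j` (the primitive idempotents of
`E ⊗_{ℚ_p} B ≅ ∏_j B`). [cite: FontaineAsterisque223III, Exp. III Prop. 1.5.2] -/
theorem exists_corner [FiniteDimensional ℚ_[p] E] :
    ∃ e : (E →ₐ[ℚ_[p]] AlgebraicClosure F) → (Fin 1 → E) ⊗[ℚ_[p]] 𝔅.B,
      (∀ j, evalEmb 𝔅 ι j hιq (e j) = 1) ∧
        ∀ j j', j' ≠ j → evalEmb 𝔅 ι j' hιq (e j) = 0 := by
  classical
  have h := fun j : E →ₐ[ℚ_[p]] AlgebraicClosure F =>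
    exists_forall_evalEmb_eq 𝔅 ι hιq (E := E) fun j' => if j' = j then 1 else 0
  choose e he using h
  exact ⟨e, fun j => by rw [he, if_pos rfl], fun j j' hj' => by rw [he, if_neg hj']⟩

/-- The corner elements sum to `1`. [cite: FontaineAsterisque223III, Exp. III Prop. 1.5.2] -/
theorem sum_corner_eq_one [FiniteDimensional ℚ_[p] E]
    {e : (E →ₐ[ℚ_[p]] AlgebraicClosure F) → (Fin 1 → E) ⊗[ℚ_[p]] 𝔅.B}
    (he1 : ∀ j, evalEmb 𝔅 ι j hιq (e j) = 1) (he0 : ∀ j j', j' ≠ j → evalEmb 𝔅 ι j' hιq (e j) = 0) :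
    ∑ j, e j = 1 := by
  classical
  refine eq_of_forall_evalEmb_eq 𝔅 ι hιq fun j' => ?_
  rw [map_sum, evalEmb_one, Finset.sum_eq_single j' (fun j _ hj => he0 j j' (Ne.symm hj))
    (fun h => absurd (Finset.mem_univ j') h), he1]

/-- A corner element lies in `(Fin 1 → E) ⊗ Fil^0 B` (when `ι(F̄) ⊆ Fil^0 B`).
[cite: FontaineAsterisque223III, Exp. III §1.5.4] -/
theorem corner_mem_coeffFilTensor_zero [FiniteDimensional ℚ_[p] E]
    (hιfil : ∀ y : AlgebraicClosure F, ι y ∈ 𝔅.fil 0)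
    {e : (E →ₐ[ℚ_[p]] AlgebraicClosure F) → (Fin 1 → E) ⊗[ℚ_[p]] 𝔅.B}
    (he1 : ∀ j, evalEmb 𝔅 ι j hιq (e j) = 1) (he0 : ∀ j j', j' ≠ j → evalEmb 𝔅 ι j' hιq (e j) = 0)
    (j : E →ₐ[ℚ_[p]] AlgebraicClosure F) : e j ∈ 𝔅.coeffFilTensor E (Fin 1 → E) 0 := by
  classical
  refine (mem_coeffFilTensor_iff_forall_evalEmb_mem 𝔅 ι hιq hιfil 0 (e j)).2 fun j' => ?_
  by_cases h : j' = j
  · rw [h, he1]; exact 𝔅.one_mem_fil_zero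
  · rw [he0 j j' h]; exact zero_mem _

/-- **A corner element is an eigenvector for both structures**: `(c ⊗ 1) e_j = (1 ⊗ ι(j c)) e_j`
for `c ∈ E`. [cite: FontaineAsterisque223III, Exp. III Prop. 1.5.2] -/
theorem const_tmul_mul_corner [FiniteDimensional ℚ_[p] E]
    {e : (E →ₐ[ℚ_[p]] AlgebraicClosure F) → (Fin 1 → E) ⊗[ℚ_[p]] 𝔅.B}
    (he0 : ∀ j j', j' ≠ j → evalEmb 𝔅 ι j' hιq (e j) = 0)
    (j : E →ₐ[ℚ_[p]] AlgebraicClosure F) (c : E) :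
    ((fun _ : Fin 1 => c) ⊗ₜ[ℚ_[p]] (1 : 𝔅.B)) * e j = ((1 : Fin 1 → E) ⊗ₜ[ℚ_[p]] ι (j c)) * e j := by
  classical
  refine eq_of_forall_evalEmb_eq 𝔅 ι hιq fun j' => ?_
  rw [evalEmb_mul, evalEmb_mul, evalEmb_const_tmul_one, evalEmb_one_tmul]
  by_cases h : j' = j
  · rw [h]
  · rw [he0 j j' h, mul_zero, mul_zero]

/-! ### Change of coefficients is multiplicative -/

section Incl

variable {E₀ : Type} [Field E₀] [Algebra ℚ_[p] E₀] [Algebra E₀ E] [IsScalarTower ℚ_[p] E₀ E]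

/-- `coeffIncl n` is the algebra map `(E₀ ⊆ E)^{⊕ n} ⊗ id_B`. [folklore] -/
private theorem coeffIncl_eq_map (n : ℕ) (x : (Fin n → E₀) ⊗[ℚ_[p]] 𝔅.B) :
    𝔅.coeffIncl (E := E) n x =
      Algebra.TensorProduct.map (((Algebra.ofId E₀ E).restrictScalars ℚ_[p]).compLeft (Fin n))
        (AlgHom.id ℚ_[p] 𝔅.B) x := by
  induction x using TensorProduct.induction_on with
  | zero => rw [map_zero, map_zero]
  | tmul m b =>
    rw [PeriodRingData.coeffIncl_tmul, Algebra.TensorProduct.map_tmul, AlgHom.id_apply]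
    rfl
  | add x y hx hy => rw [map_add, map_add, hx, hy]

/-- **`coeffIncl` is multiplicative.** [cite: Patrikis2019, §2.7.1] -/
theorem coeffIncl_mul (n : ℕ) (x y : (Fin n → E₀) ⊗[ℚ_[p]] 𝔅.B) :
    𝔅.coeffIncl (E := E) n (x * y) = 𝔅.coeffIncl (E := E) n x * 𝔅.coeffIncl (E := E) n y := by
  rw [coeffIncl_eq_map, coeffIncl_eq_map, coeffIncl_eq_map, map_mul]

/-- `coeffIncl 1 = 1`. [cite: Patrikis2019, §2.7.1] -/
theorem coeffIncl_one (n : ℕ) : 𝔅.coeffIncl (E := E) n (1 : (Fin n → E₀) ⊗[ℚ_[p]] 𝔅.B) = 1 := by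
  rw [coeffIncl_eq_map, map_one]

/-- `coeffIncl` of `1 ⊗ b`. [cite: Patrikis2019, §2.7.1] -/
theorem coeffIncl_one_tmul (n : ℕ) (b : 𝔅.B) :
    𝔅.coeffIncl (E := E) n ((1 : Fin n → E₀) ⊗ₜ[ℚ_[p]] b) = (1 : Fin n → E) ⊗ₜ[ℚ_[p]] b := by
  rw [PeriodRingData.coeffIncl_tmul]
  congr 1
  funext i
  rw [Pi.one_apply, map_one, Pi.one_apply]

/-- `coeffIncl` of a constant vector `c ⊗ b`. [cite: Patrikis2019, §2.7.1] -/
theorem coeffIncl_const_tmul (c : E₀) (b : 𝔅.B) :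
    𝔅.coeffIncl (E := E) 1 ((fun _ : Fin 1 => c) ⊗ₜ[ℚ_[p]] b) =
      (fun _ : Fin 1 => algebraMap E₀ E c) ⊗ₜ[ℚ_[p]] b := by
  rw [PeriodRingData.coeffIncl_tmul]

end Incl

/-! ### Off-label corners kill the isotypic part -/

section OffLabel

variable {E₀ : Type} [Field E₀] [Algebra ℚ_[p] E₀]

/-- **Off-label corners kill the `τ`-isotypic part.**  Let `e ∈ (Fin 1 → E₀) ⊗ B` satisfy
`(c ⊗ 1) e = (1 ⊗ ι(j c)) e` for all `c ∈ E₀`, with `j : E₀ → F̄` NOT over the label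
`τ₀ : F → E₀`.  Then over any coefficient field `E ⊇ E₀` and any `E`-space `M`, `e · x = 0` for
every `x ∈ M ⊗_{ℚ_p} B` with `(id ⊗ a) x = τ₀(a) x` (`a ∈ F`): indeed `e · x` is killed by
`id ⊗ ι(a - j(τ₀ a))`, which is injective. [cite: FontaineAsterisque223III, Exp. III Prop. 1.5.2]
[cite: Patrikis2019, §2.3.1] -/
theorem perMul_coeffIncl_eq_zero_of_ne
    (hιa : ∀ a : F, ι (algebraMap F (AlgebraicClosure F) a) = algebraMap F 𝔅.B a)
    (τ₀ : F →ₐ[ℚ_[p]] E₀) (j : E₀ →ₐ[ℚ_[p]] AlgebraicClosure F)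
    (hj : ∃ a : F, j (τ₀ a) ≠ algebraMap F (AlgebraicClosure F) a)
    {e : (Fin 1 → E₀) ⊗[ℚ_[p]] 𝔅.B}
    (he : ∀ c : E₀, ((fun _ : Fin 1 => c) ⊗ₜ[ℚ_[p]] (1 : 𝔅.B)) * e =
      ((1 : Fin 1 → E₀) ⊗ₜ[ℚ_[p]] ι (j c)) * e)
    {E : Type} [Field E] [Algebra ℚ_[p] E] [Algebra E₀ E] [IsScalarTower ℚ_[p] E₀ E]
    {M : Type} [AddCommGroup M] [Module E M] [Module ℚ_[p] M] [IsScalarTower ℚ_[p] E M]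
    {x : M ⊗[ℚ_[p]] 𝔅.B} (hx : ∀ a : F, 𝔅.baseAct E M a x = algebraMap E₀ E (τ₀ a) • x) :
    𝔅.perMul E M (𝔅.coeffIncl 1 e) x = 0 := by
  obtain ⟨a, ha⟩ := hj
  set w := 𝔅.perMul E M (𝔅.coeffIncl 1 e) x with hw
  -- `(id ⊗ a) w = τ₀(a) w`
  have h1 : 𝔅.baseActB E M (algebraMap F 𝔅.B a) w = algebraMap E₀ E (τ₀ a) • w := by
    rw [PeriodRingData.baseActB_algebraMap, hw, PeriodRingData.baseAct_perMul, hx a, map_smul]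
  -- `(id ⊗ ι(j(τ₀ a))) w = τ₀(a) w`, from the eigen-relation of `e`
  have h2 : 𝔅.baseActB E M (ι (j (τ₀ a))) w = algebraMap E₀ E (τ₀ a) • w := by
    have h := congrArg (fun z => 𝔅.perMul E M (𝔅.coeffIncl (E := E) 1 z) x) (he (τ₀ a))
    simp only [coeffIncl_mul, map_mul, Module.End.mul_apply, coeffIncl_const_tmul,
      coeffIncl_one_tmul, PeriodRingData.perMul_tmul_apply, PeriodRingData.baseActB_one,
      Pi.one_apply, one_smul] at h
    rw [hw]
    exact h.symm
  -- subtract: `(id ⊗ ι(a - j(τ₀ a))) w = 0`, and `ι(a - j(τ₀ a))` is a unit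
  have hδ : algebraMap F (AlgebraicClosure F) a - j (τ₀ a) ≠ 0 := sub_ne_zero.mpr (Ne.symm ha)
  have hu : IsUnit (ι (algebraMap F (AlgebraicClosure F) a - j (τ₀ a))) := (Ne.isUnit hδ).map ι
  obtain ⟨u, hu'⟩ := hu
  have h3 : 𝔅.baseActB E M (u : 𝔅.B) w = 𝔅.baseActB E M (u : 𝔅.B) 0 := by
    rw [map_zero, hu', map_sub, hιa, ← PeriodRingData.baseActBAlgHom_apply, map_sub,
      LinearMap.sub_apply, PeriodRingData.baseActBAlgHom_apply, PeriodRingData.baseActBAlgHom_apply,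
      h1, h2, sub_self]
  exact PeriodRingData.baseActB_injective 𝔅 u h3

end OffLabel

/-! ### The corner unit -/

section Unit

variable {E₀ : Type} [Field E₀] [Algebra ℚ_[p] E₀] [FiniteDimensional ℚ_[p] E₀]

/-- **The corner unit.**  Let `d₀ ∈ (Fin 1 → E₀) ⊗ B` have `ev_j d₀ = 0` at the embeddings `j`
NOT over `τ₀` and `ev_j d₀` invertible with an inverse in `Fil^{-k} B` at the embeddings over
`τ₀`.  Then there is `u₀ ∈ (Fin 1 → E₀) ⊗ Fil^{-k} B` such that `u₀ d₀` acts as the identity on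
the `τ`-isotypic part of `M ⊗_{ℚ_p} B` for EVERY coefficient field `E ⊇ E₀` and `E`-space `M`
(`τ = (E₀ ⊆ E) ∘ τ₀`): `u₀ d₀ = Σ_{j over τ₀} e_j` and the off-label corners act by zero.
[cite: FontaineAsterisque223III, Exp. III Prop. 1.5.2] [cite: Patrikis2019, §2.3.1, §2.7.1] -/
theorem exists_twistUnit
    (hιa : ∀ a : F, ι (algebraMap F (AlgebraicClosure F) a) = algebraMap F 𝔅.B a)
    (hιfil : ∀ y : AlgebraicClosure F, ι y ∈ 𝔅.fil 0)
    (τ₀ : F →ₐ[ℚ_[p]] E₀) (k : ℤ) {d₀ : (Fin 1 → E₀) ⊗[ℚ_[p]] 𝔅.B}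
    (hoff : ∀ j : E₀ →ₐ[ℚ_[p]] AlgebraicClosure F,
      (∃ a : F, j (τ₀ a) ≠ algebraMap F (AlgebraicClosure F) a) → evalEmb 𝔅 ι j hιq d₀ = 0)
    (hon : ∀ j : E₀ →ₐ[ℚ_[p]] AlgebraicClosure F,
      (∀ a : F, j (τ₀ a) = algebraMap F (AlgebraicClosure F) a) →
        ∃ y ∈ 𝔅.fil (-k), y * evalEmb 𝔅 ι j hιq d₀ = 1) :
    ∃ u₀ ∈ 𝔅.coeffFilTensor E₀ (Fin 1 → E₀) (-k),
      ∀ {E : Type} [Field E] [Algebra ℚ_[p] E] [Algebra E₀ E] [IsScalarTower ℚ_[p] E₀ E]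
        {M : Type} [AddCommGroup M] [Module E M] [Module ℚ_[p] M] [IsScalarTower ℚ_[p] E M]
        (x : M ⊗[ℚ_[p]] 𝔅.B), (∀ a : F, 𝔅.baseAct E M a x = algebraMap E₀ E (τ₀ a) • x) →
          𝔅.perMul E M (𝔅.coeffIncl 1 (u₀ * d₀)) x = x := by
  classical
  choose y hyfil hy using hon
  -- the prescribed evaluations of `u₀`
  set t : (E₀ →ₐ[ℚ_[p]] AlgebraicClosure F) → 𝔅.B := fun j =>
    if h : ∀ a : F, j (τ₀ a) = algebraMap F (AlgebraicClosure F) a then y j h else 0 with htdef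
  obtain ⟨u₀, hu₀⟩ := exists_forall_evalEmb_eq 𝔅 ι hιq (E := E₀) t
  obtain ⟨e, he1, he0⟩ := exists_corner 𝔅 ι hιq (E := E₀)
  -- `u₀ d₀ = Σ_{j over τ₀} e_j`
  set J : Finset (E₀ →ₐ[ℚ_[p]] AlgebraicClosure F) :=
    Finset.univ.filter fun j => ∀ a : F, j (τ₀ a) = algebraMap F (AlgebraicClosure F) a with hJdef
  have hud : u₀ * d₀ = ∑ j ∈ J, e j := by
    refine eq_of_forall_evalEmb_eq 𝔅 ι hιq fun j' => ?_
    rw [evalEmb_mul, hu₀, map_sum]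
    by_cases h : ∀ a : F, j' (τ₀ a) = algebraMap F (AlgebraicClosure F) a
    · have hj'J : j' ∈ J := Finset.mem_filter.mpr ⟨Finset.mem_univ _, h⟩
      rw [Finset.sum_eq_single j' (fun j _ hj => he0 j j' (Ne.symm hj)) (fun h' => absurd hj'J h'),
        he1, htdef]
      simp only [dif_pos h]
      exact hy j' h
    · have hj'J : j' ∉ J := fun h' => h (Finset.mem_filter.mp h').2
      rw [hoff j' (by push Not at h; exact h), mul_zero,
        Finset.sum_eq_zero fun j hj => he0 j j' fun hjj' => hj'J (hjj' ▸ hj)]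
  refine ⟨u₀, ?_, ?_⟩
  · refine (mem_coeffFilTensor_iff_forall_evalEmb_mem 𝔅 ι hιq hιfil (-k) u₀).2 fun j' => ?_
    rw [hu₀, htdef]
    by_cases h : ∀ a : F, j' (τ₀ a) = algebraMap F (AlgebraicClosure F) a
    · simp only [dif_pos h]; exact hyfil j' h
    · simp only [dif_neg h]; exact zero_mem _
  · intro E _ _ _ _ M _ _ _ _ x hx
    rw [hud, map_sum, map_sum, LinearMap.sum_apply, Finset.sum_subset (Finset.subset_univ J)
      (fun j _ hj => perMul_coeffIncl_eq_zero_of_ne 𝔅 ι hιa τ₀ j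
        (by have h : ¬ ∀ a : F, j (τ₀ a) = algebraMap F (AlgebraicClosure F) a := fun h' =>
              hj (Finset.mem_filter.mpr ⟨Finset.mem_univ j, h'⟩)
            push Not at h; exact h)
        (const_tmul_mul_corner 𝔅 ι hιq he0 j) hx),
      ← LinearMap.sum_apply, ← map_sum, ← map_sum, sum_corner_eq_one 𝔅 ι hιq he1 he0,
      coeffIncl_one, map_one, Module.End.one_apply]

end Unit

/-! ### The twisting theorem -/

section Twist

variable {E₀ : Type} [Field E₀] [Algebra ℚ_[p] E₀] [FiniteDimensional ℚ_[p] E₀]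
  [TopologicalSpace E₀] [IsTopologicalRing E₀]

/-- The determinant of the base change of a rank-one framed representation.
[cite: Patrikis2019, §2.7.1] -/
theorem det_baseChange_fin_one {E' : Type} [Field E'] [TopologicalSpace E'] [IsTopologicalRing E']
    (f : E₀ →+* E') (hf : Continuous f) (rE₀ : FramedRep (absoluteGaloisGroup F) E₀ 1)
    (σ : absoluteGaloisGroup F) :
    ((FramedRep.det (rE₀.baseChange f hf) σ : E'ˣ) : E') = f ((FramedRep.det rE₀ σ : E₀ˣ) : E₀) := by
  rw [FramedRep.det_apply, FramedRep.det_apply, Matrix.GeneralLinearGroup.val_det_apply,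
    Matrix.GeneralLinearGroup.val_det_apply, FramedRep.coe_baseChange_apply, Matrix.det_fin_one,
    Matrix.det_fin_one, Matrix.map_apply]

/-- **Exactness of the generator at every embedding over the label.**  If
`d₀ ∈ D_{τ₀}(rE₀) ∩ (E₀ ⊗ Fil^k B) ∖ (E₀ ⊗ Fil^{k+1} B)` then `ev_j d₀ ∈ Fil^k B ∖ Fil^{k+1} B` for
EVERY `j` over `τ₀` (the embeddings over `τ₀` form one `Γ_F`-orbit, along which `ev d₀` is
transported by units of `Fil^0`; off `τ₀` the evaluations vanish).
[cite: FontaineAsterisque223III, Exp. III Prop. 1.5.2] [cite: Patrikis2019, §2.3.1] -/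
theorem evalEmb_not_mem_fil_of_generator
    (hισ : ∀ (σ : absoluteGaloisGroup F) (x : AlgebraicClosure F), σ • ι x = ι (σ • x))
    (hιa : ∀ a : F, ι (algebraMap F (AlgebraicClosure F) a) = algebraMap F 𝔅.B a)
    (hιfil : ∀ y : AlgebraicClosure F, ι y ∈ 𝔅.fil 0)
    (rE₀ : FramedRep (absoluteGaloisGroup F) E₀ 1) (τ₀ : F →ₐ[ℚ_[p]] E₀) (k : ℤ)
    {d₀ : (Fin 1 → E₀) ⊗[ℚ_[p]] 𝔅.B}
    (hd₀ : d₀ ∈ 𝔅.labelD (FramedRep.toContinuousRep rE₀) τ₀.toRingHom)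
    (hdk1 : d₀ ∉ 𝔅.coeffFilTensor E₀ (Fin 1 → E₀) (k + 1))
    (j : E₀ →ₐ[ℚ_[p]] AlgebraicClosure F)
    (hj : ∀ a : F, j (τ₀ a) = algebraMap F (AlgebraicClosure F) a) :
    evalEmb 𝔅 ι j hιq d₀ ∉ 𝔅.fil (k + 1) := by
  intro hz
  apply hdk1
  refine (mem_coeffFilTensor_iff_forall_evalEmb_mem 𝔅 ι hιq hιfil (k + 1) d₀).2 fun j' => ?_
  by_cases hj' : ∀ a : F, j' (τ₀ a) = algebraMap F (AlgebraicClosure F) a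
  · obtain ⟨σ, rfl⟩ := exists_absGalEmbComp_eq τ₀ j j' hj hj'
    rw [evalEmb_absGalEmbComp 𝔅 ι j hιq hισ rE₀
      (𝔅.labelD_le_coeffD (FramedRep.toContinuousRep rE₀) τ₀.toRingHom hd₀) σ]
    refine 𝔅.smul_mem_fil σ (k + 1) _ ?_
    have h := 𝔅.mul_mem_fil 0 (k + 1) (ι (j ((FramedRep.det rE₀ σ : E₀ˣ) : E₀)))
      (evalEmb 𝔅 ι j hιq d₀) (hιfil _) hz
    rwa [zero_add] at h
  · push Not at hj'
    rw [evalEmb_eq_zero_of_mem_labelD 𝔅 ι j' hιq hιa _ τ₀ hd₀ hj']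
    exact zero_mem _

/-- **The twisting theorem for labelled Hodge–Tate weights (abstract period ring).**
Let `ι : F̄ → B` be a `Γ_F`-equivariant section over `F` with `ι(F̄) ⊆ Fil^0 B`, and suppose every
`z ∈ Fil^i B ∖ Fil^{i+1} B` has an inverse in `Fil^{-i} B` (as in the field `B_dR`).  Let
`rE₀ : Γ_F → GL₁(E₀)` (`E₀/ℚ_p` finite), `τ₀ : F → E₀`, and
`d₀ ∈ D_{τ₀}(rE₀) ∩ (E₀ ⊗ Fil^k) ∖ (E₀ ⊗ Fil^{k+1})` — a generator of exact `τ₀`-weight `k`.  Then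
for every coefficient field `E ⊇ E₀` (continuous inclusion), every `E`-representation `ρ` of `Γ_F`
on `M`, and `ρ' = (det rE₀) · ρ`: **`HT_τ(ρ') = HT_τ(ρ) + k`**, `τ = (E₀ ⊆ E) ∘ τ₀`.
(Patrikis: `HT_τ(ρ ⊗ χ) = {h + HT_τ(χ)}`.) [cite: Patrikis2019, §2.3.1 and §2.7.1]
[cite: FontaineAsterisque223III, Exp. III Prop. 1.5.2] -/
theorem labelledHodgeTateWeights_twist_of_generator
    (hισ : ∀ (σ : absoluteGaloisGroup F) (x : AlgebraicClosure F), σ • ι x = ι (σ • x))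
    (hιa : ∀ a : F, ι (algebraMap F (AlgebraicClosure F) a) = algebraMap F 𝔅.B a)
    (hιfil : ∀ y : AlgebraicClosure F, ι y ∈ 𝔅.fil 0)
    (hinv : ∀ (i : ℤ) (z : 𝔅.B), z ∈ 𝔅.fil i → z ∉ 𝔅.fil (i + 1) → ∃ y ∈ 𝔅.fil (-i), y * z = 1)
    (rE₀ : FramedRep (absoluteGaloisGroup F) E₀ 1) (τ₀ : F →ₐ[ℚ_[p]] E₀) (k : ℤ)
    {d₀ : (Fin 1 → E₀) ⊗[ℚ_[p]] 𝔅.B}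
    (hd₀ : d₀ ∈ 𝔅.labelD (FramedRep.toContinuousRep rE₀) τ₀.toRingHom)
    (hdk : d₀ ∈ 𝔅.coeffFilTensor E₀ (Fin 1 → E₀) k)
    (hdk1 : d₀ ∉ 𝔅.coeffFilTensor E₀ (Fin 1 → E₀) (k + 1))
    {E : Type} [Field E] [Algebra ℚ_[p] E] [Algebra E₀ E] [IsScalarTower ℚ_[p] E₀ E]
    [TopologicalSpace E] [IsTopologicalRing E] (hc : Continuous (algebraMap E₀ E))
    {M : Type} [AddCommGroup M] [Module E M] [Module ℚ_[p] M] [IsScalarTower ℚ_[p] E M]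
    [TopologicalSpace M]
    (ρ ρ' : ContinuousRep (absoluteGaloisGroup F) E M)
    (hρ' : ∀ σ m, ρ' σ m = algebraMap E₀ E ((FramedRep.det rE₀ σ : E₀ˣ) : E₀) • ρ σ m) :
    𝔅.labelledHodgeTateWeights ρ' ((algebraMap E₀ E).comp τ₀.toRingHom) =
      (𝔅.labelledHodgeTateWeights ρ ((algebraMap E₀ E).comp τ₀.toRingHom)).map (· + k) := by
  classical
  have hιq : ∀ c : ℚ_[p], algebraMap ℚ_[p] 𝔅.B c = ι (algebraMap ℚ_[p] (AlgebraicClosure F) c) :=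
    algebraMap_padic_eq_iota 𝔅 ι hιa
  -- evaluations of `d₀`: zero off `τ₀`, in `Fil^k ∖ Fil^{k+1}` (hence invertible) over `τ₀`
  have hoff : ∀ j : E₀ →ₐ[ℚ_[p]] AlgebraicClosure F,
      (∃ a : F, j (τ₀ a) ≠ algebraMap F (AlgebraicClosure F) a) → evalEmb 𝔅 ι j hιq d₀ = 0 :=
    fun j hj => evalEmb_eq_zero_of_mem_labelD 𝔅 ι j hιq hιa _ τ₀ hd₀ hj
  have hon : ∀ j : E₀ →ₐ[ℚ_[p]] AlgebraicClosure F,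
      (∀ a : F, j (τ₀ a) = algebraMap F (AlgebraicClosure F) a) →
        ∃ y ∈ 𝔅.fil (-k), y * evalEmb 𝔅 ι j hιq d₀ = 1 := fun j hj =>
    hinv k _ ((mem_coeffFilTensor_iff_forall_evalEmb_mem 𝔅 ι hιq hιfil k d₀).1 hdk j)
      (evalEmb_not_mem_fil_of_generator 𝔅 ι hιq hισ hιa hιfil rE₀ τ₀ k hd₀ hdk1 j hj)
  obtain ⟨u₀, hu₀, hud⟩ := exists_twistUnit 𝔅 ι hιq hιa hιfil τ₀ k hoff hon
  -- the twisting character over `E` and the abstract twisting theorem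
  set χ₁ := FramedRep.toContinuousRep (rE₀.baseChange (algebraMap E₀ E) hc) with hχ₁
  have hχ₁a : ∀ (σ : absoluteGaloisGroup F) (c : Fin 1 → E),
      χ₁ σ c = algebraMap E₀ E ((FramedRep.det rE₀ σ : E₀ˣ) : E₀) • c := by
    intro σ c
    rw [hχ₁, toContinuousRep_apply_eq_det_smul, det_baseChange_fin_one]
  have hdD : 𝔅.coeffIncl (E := E) 1 d₀ ∈ 𝔅.coeffD χ₁ := by
    refine (PeriodRingData.mem_coeffD_iff 𝔅 χ₁ _).2 fun σ => ?_
    rw [hχ₁, ← 𝔅.coeffIncl_coeffTensorRep rE₀ hc σ d₀,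
      (PeriodRingData.mem_coeffD_iff 𝔅 _ d₀).1
        (𝔅.labelD_le_coeffD (FramedRep.toContinuousRep rE₀) τ₀.toRingHom hd₀) σ]
  have hdk' : 𝔅.coeffIncl (E := E) 1 d₀ ∈ 𝔅.coeffFilTensor E (Fin 1 → E) k :=
    (𝔅.coeffIncl_mem_coeffFilTensor_iff 1 k d₀).2 hdk
  have huk' : 𝔅.coeffIncl (E := E) 1 u₀ ∈ 𝔅.coeffFilTensor E (Fin 1 → E) (-k) :=
    (𝔅.coeffIncl_mem_coeffFilTensor_iff 1 (-k) u₀).2 hu₀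
  refine 𝔅.labelledHodgeTateWeights_of_twistUnit
    (fun σ => algebraMap E₀ E ((FramedRep.det rE₀ σ : E₀ˣ) : E₀)) χ₁ ρ ρ'
    ((algebraMap E₀ E).comp τ₀.toRingHom) k hχ₁a hρ' hdD hdk' huk' fun x hx => ?_
  rw [← coeffIncl_mul]
  exact hud x fun a => by rw [hx a]; rfl

end Twist

end RankOneLabelledWeights

end Literature.NumberTheory.PAdicHodge
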